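import Summits.CriticalPhenomena.PercolationContinuityZ3.Theorems.PercNearOneGluingNoHeavyLowerTailSahiIrreducibleTools
import Summits.CriticalPhenomena.PercolationContinuityZ3.Theorems.PercNearOneGluingNoHeavyLowerTailIncStarIrreducible
import HarnessLib

/-!
# Sahi positivity of EVERY ORDER for principal cluster families reduces to irreducible marked graphs

Support file for the Sahi programme (`--supports stmt-CriticalPhenomena-4575`, prover prim-sahi-p2 gen 12).  No definitions, no named
facts, no sorries; standard axioms.  Memo `…/prim-sahi-p2/PROOF-E3.md` §23l.  The every-order companion of
`IncStarIrreducible.incStar_of_irreducible` (which treats `E₃` of three root-connection events).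

**Theorem `sahiE_principal_of_irreducible`.**  Suppose that for every weight `w` on `Fin n`, every root `s` and every family of target sets
`T : Fin k → Finset (Fin n)` such that the marked weighted graph `(w; s, ⋃ T)` is IRREDUCIBLE — `w` loop-free; 2-connected (every cut decomposition
`V₁ ∪ V₂`, `V₁ ∩ V₂ = {x}`, `s ∈ V₁`, no positive pair between `V₁ ∖ x` and `V₂ ∖ x`, is trivial); every vertex that is neither the root nor a
target has a positive neighbour outside any two given vertices; no nonempty `B` avoiding root, targets and two vertices `u ≠ v` is cut off by
`{u,v}` (no blob); no `R ∋ s` with a second vertex, avoiding the targets and `u ≠ v`, is cut off by `{u,v}` (no targetless root side) — the Sahi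
functional is nonnegative: `0 ≤ E_k(1_{C_s ⊇ T_0}, …, 1_{C_s ⊇ T_{k-1}})`.  Then `E_k ≥ 0` for EVERY principal cluster family of every root on every
finite weighted graph, at every order `k`.  (No distinctness of marks is needed at the level of families of target SETS.)

**Proof** = strong induction on the number of vertices with the every-order reductions already in the tree: cut vertex
(`SahiPrincipalCutVertex.sahiE_principal_of_cutVertex_univ`, gen 9), series (`SahiSeriesReduction.sahiE_principal_seriesReduce`, gen 10), blob
(`SahiBlobReduction.exists_blobReduce`, gen 11), root side (`SahiRootSide.sahiE_principal_of_rootSide`, gen 12), transported by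
`IncStarIrreducible.sahiE_principal_openConnIn_of_fin`; loops are invisible to the events.
-/

noncomputable section

namespace Summit.CriticalPhenomena.PercolationContinuityZ3.Theorems

namespace IncStarIrreducible

open Finset MeasureTheory Literature.Combinatorics.Sahi2008 Literature.Probability.Percolation
  Literature.Probability.LatticeModels
open Literature.Probability.Percolation.DecisionTree (ind ind_of_mem ind_of_not_mem ind_nonneg)
open Literature.Probability.Percolation.BlockExploration (exists_openWalk_of_mem_openConnIn
  mem_openConn_iff_openConnIn_univ)
open scoped Classical

variable {V : Type*} [Fintype V]

/-- Principal families ignore loops: their Sahi functionals are unchanged when the diagonal pairs are switched off. [this work] -/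
theorem sahiE_principal_openConn_congr_offDiag (w w' : Sym2 V → unitInterval)
    (h : ∀ e : Sym2 V, ¬ e.IsDiag → w e = w' e) (x : V) (k : ℕ) (T : Fin k → Finset V) :
    sahiE (bernoulliWeight w) k (fun i => ind (⋂ t ∈ T i, (openConn x t : Set (BondConfig V)))) =
      sahiE (bernoulliWeight w') k (fun i => ind (⋂ t ∈ T i, (openConn x t : Set (BondConfig V)))) := by
  simp only [openConn_eq_openConnIn_univ]
  exact sahiE_principal_openConnIn_congr_weight w w' Set.univ (fun e he _ => h e he) x k T

/-- **Sahi positivity of every order for principal cluster families holds everywhere as soon as it holds on irreducible marked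
weighted graphs** (marks = root and the union of the target sets of the family at hand).  See the module docstring for the clauses and
the reductions used. [this work] -/
theorem sahiE_principal_of_irreducible
    (H : ∀ (n : ℕ) (w : Sym2 (Fin n) → unitInterval) (s : Fin n) (k : ℕ) (T : Fin k → Finset (Fin n)),
      (∀ x : Fin n, w s(x, x) = 0) →
      (∀ (V₁ V₂ : Finset (Fin n)) (x : Fin n), (∀ y, y ∈ V₁ → y ∈ V₂ → y = x) → x ∈ V₁ → x ∈ V₂ → s ∈ V₁ →
          (∀ y, y ∈ V₁ ∨ y ∈ V₂) → (∀ y z, y ∈ V₁ → z ∈ V₂ → y ≠ x → z ≠ x → w s(y, z) = 0) →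
          (∀ y ∈ V₁, y = x) ∨ (∀ z ∈ V₂, z = x)) →
      (∀ x y y' : Fin n, x ≠ s → (∀ i, x ∉ T i) → x ≠ y → x ≠ y' → y ≠ y' →
          ∃ z, z ≠ y ∧ z ≠ y' ∧ w s(x, z) ≠ 0) →
      (∀ (B : Finset (Fin n)) (u v : Fin n), B.Nonempty → u ∉ B → v ∉ B → u ≠ v → s ∉ B → (∀ i, ∀ t ∈ T i, t ∉ B) →
          ∃ x ∈ B, ∃ z, z ∉ B ∧ z ≠ u ∧ z ≠ v ∧ w s(x, z) ≠ 0) →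
      (∀ (R : Finset (Fin n)) (h u v : Fin n), s ∈ R → h ∈ R → h ≠ s → u ∉ R → v ∉ R → u ≠ v → (∀ i, ∀ t ∈ T i, t ∉ R) →
          ∃ x ∈ R, ∃ z, z ∉ R ∧ z ≠ u ∧ z ≠ v ∧ w s(x, z) ≠ 0) →
      0 ≤ sahiE (bernoulliWeight w) k (fun i => ind (⋂ t ∈ T i, (openConn s t : Set (BondConfig (Fin n))))))
    (w : Sym2 V → unitInterval) (s : V) (k : ℕ) (T : Fin k → Finset V) :
    0 ≤ sahiE (bernoulliWeight w) k (fun i => ind (⋂ t ∈ T i, (openConn s t : Set (BondConfig V)))) := by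
  -- the statement on `Fin n`, by strong induction on `n`
  have finv : ∀ (n : ℕ) (w : Sym2 (Fin n) → unitInterval) (s : Fin n) (k : ℕ) (T : Fin k → Finset (Fin n)),
      0 ≤ sahiE (bernoulliWeight w) k (fun i => ind (⋂ t ∈ T i, (openConn s t : Set (BondConfig (Fin n))))) := by
    intro n
    induction n using Nat.strong_induction_on with
    | _ n ih =>
    intro w₁ s k T
    -- loops off
    obtain ⟨w, hwdef⟩ : ∃ w : Sym2 (Fin n) → unitInterval, ∀ e, w e = if e.IsDiag then 0 else w₁ e := ⟨_, fun e => rfl⟩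
    rw [sahiE_principal_openConn_congr_offDiag w₁ w (fun e he => by rw [hwdef, if_neg he]) s k T]
    have hloop : ∀ x : Fin n, w s(x, x) = 0 := fun x => by rw [hwdef, if_pos (Sym2.mk_isDiag_iff.2 rfl)]
    have hcardn : Fintype.card (Fin n) = n := Fintype.card_fin n
    -- the induction hypothesis, transported into any proper vertex set
    have IH : ∀ (w' : Sym2 (Fin n) → unitInterval) (S : Finset (Fin n)), S.card < n → ∀ {x : Fin n}, x ∈ S →
        ∀ (m : ℕ) (T' : Fin m → Finset (Fin n)), (∀ j, ∀ t ∈ T' j, t ∈ S) →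
        0 ≤ sahiE (bernoulliWeight w') m
          (fun j => ind (⋂ t ∈ T' j, (openConnIn (↑S : Set (Fin n)) x t : Set (BondConfig (Fin n))))) :=
      fun w' S hS x hx m T' hT' => sahiE_principal_openConnIn_of_fin (ih S.card hS) w' S rfl hx m T' hT'
    -- (1) a cut vertex
    by_cases hI1 : ∀ (V₁ V₂ : Finset (Fin n)) (x : Fin n), (∀ y, y ∈ V₁ → y ∈ V₂ → y = x) → x ∈ V₁ → x ∈ V₂ → s ∈ V₁ →
        (∀ y, y ∈ V₁ ∨ y ∈ V₂) → (∀ y z, y ∈ V₁ → z ∈ V₂ → y ≠ x → z ≠ x → w s(y, z) = 0) →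
        (∀ y ∈ V₁, y = x) ∨ (∀ z ∈ V₂, z = x)
    swap
    · push Not at hI1
      obtain ⟨V₁, V₂, x, hV, hx₁, hx₂, hs₁, hunion, hsep, ⟨y₀, hy₀, hy₀x⟩, ⟨z₀, hz₀, hz₀x⟩⟩ := hI1
      have hz₀V₁ : z₀ ∉ V₁ := fun h => hz₀x (hV z₀ h hz₀)
      have hy₀V₂ : y₀ ∉ V₂ := fun h => hy₀x (hV y₀ hy₀ h)
      have hlt₁ : V₁.card < n := by simpa [hcardn] using Finset.card_lt_univ_of_notMem hz₀V₁
      have hlt₂ : V₂.card < n := by simpa [hcardn] using Finset.card_lt_univ_of_notMem hy₀V₂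
      refine SahiPrincipalCutVertex.sahiE_principal_of_cutVertex_univ w (V₁ := (↑V₁ : Set (Fin n))) (V₂ := (↑V₂ : Set (Fin n)))
        (a := x) (s := s) (fun y hy hy' => hV y hy hy') hx₁ hx₂ hs₁ (fun y => ?_)
        (fun y z hy hz hyx hzx => hsep y z hy hz hyx hzx)
        (fun m T' hT' => IH w V₁ hlt₁ hs₁ m T' hT') (fun m T' hT' => IH w V₂ hlt₂ hx₂ m T' hT') T
      rcases hunion y with h | h
      · exact Or.inl h
      · exact Or.inr h
    -- (2) an unmarked vertex of degree ≤ 2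
    by_cases hI2 : ∀ x y y' : Fin n, x ≠ s → (∀ i, x ∉ T i) → x ≠ y → x ≠ y' → y ≠ y' →
        ∃ z, z ≠ y ∧ z ≠ y' ∧ w s(x, z) ≠ 0
    swap
    · push Not at hI2
      obtain ⟨x, y, y', hxs, hxT, hxy, hxy', hyy', hdeg⟩ := hI2
      have hval : (1 : ℝ) - (1 - w s(y, y')) * (1 - w s(x, y) * w s(x, y')) ∈ unitInterval := by
        have p0 := (w s(y, y')).2.1; have p1 := (w s(y, y')).2.2
        have q0 := (w s(x, y)).2.1; have q1 := (w s(x, y)).2.2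
        have r0 := (w s(x, y')).2.1; have r1 := (w s(x, y')).2.2
        constructor <;> nlinarith [mul_nonneg q0 r0, mul_le_one₀ q1 r0 r1]
      obtain ⟨w', hw'def⟩ : ∃ w' : Sym2 (Fin n) → unitInterval, ∀ e, w' e =
          if x ∈ e then 0 else if e = s(y, y') then ⟨_, hval⟩ else w e := ⟨_, fun e => rfl⟩
      have hw'x : ∀ z, w' s(x, z) = 0 := fun z => by rw [hw'def, if_pos (Sym2.mem_mk_left x z)]
      have hw'e : ∀ e, x ∉ e → e ≠ s(y, y') → w' e = w e := fun e he hne => by rw [hw'def, if_neg he, if_neg hne]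
      have hw'yy : (w' s(y, y') : ℝ) = 1 - (1 - w s(y, y')) * (1 - w s(x, y) * w s(x, y')) := by
        have hx : x ∉ s(y, y') := by
          intro h; rcases Sym2.mem_iff.1 h with h | h; exacts [hxy h, hxy' h]
        rw [hw'def, if_neg hx, if_pos rfl]
      rw [SahiSeriesReduction.sahiE_principal_seriesReduce w w' hxy hxy' hyy' (Ne.symm hxs)
        (fun z hz hz' => hdeg z hz hz') hw'x hw'e hw'yy k T hxT]
      set S : Finset (Fin n) := Finset.univ.erase x with hSdef
      have hSexit : ∀ p ∈ (↑S : Set (Fin n)), ∀ q ∉ (↑S : Set (Fin n)), w' s(p, q) = 0 := by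
        intro p _ q hq
        have hqx : q = x := by
          by_contra h; exact hq (Finset.mem_coe.2 (Finset.mem_erase.2 ⟨h, Finset.mem_univ q⟩))
        rw [hqx, Sym2.eq_swap]; exact hw'x p
      have memS : ∀ {p : Fin n}, p ≠ x → p ∈ S := fun hp => Finset.mem_erase.2 ⟨hp, Finset.mem_univ _⟩
      rw [sahiE_principal_openConn_eq_openConnIn_of_no_exit w' (↑S) hSexit (Finset.mem_coe.2 (memS (Ne.symm hxs))) k T]
      have hScard : S.card < n := by
        rw [hSdef, Finset.card_erase_of_mem (Finset.mem_univ x), Finset.card_univ, hcardn]; omega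
      exact IH w' S hScard (memS (Ne.symm hxs)) k T fun i t ht => memS fun htx => hxT i (htx ▸ ht)
    -- (3) a blob
    by_cases hI3 : ∀ (B : Finset (Fin n)) (u v : Fin n), B.Nonempty → u ∉ B → v ∉ B → u ≠ v → s ∉ B →
        (∀ i, ∀ t ∈ T i, t ∉ B) → ∃ x ∈ B, ∃ z, z ∉ B ∧ z ≠ u ∧ z ≠ v ∧ w s(x, z) ≠ 0
    swap
    · push Not at hI3
      obtain ⟨B, u, v, hBne, hu, hv, huv, hsB, hTB, hblob⟩ := hI3
      obtain ⟨w', hw'B, -, -, hE⟩ := SahiBlobReduction.exists_blobReduce w B hu hv huv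
        (fun x hx z hz hzu hzv => hblob x hx z hz hzu hzv)
      rw [hE s hsB k T hTB]
      set S : Finset (Fin n) := Finset.univ \ B with hSdef
      have memS : ∀ {p : Fin n}, p ∉ B → p ∈ S := fun hp => Finset.mem_sdiff.2 ⟨Finset.mem_univ _, hp⟩
      have hSexit : ∀ p ∈ (↑S : Set (Fin n)), ∀ q ∉ (↑S : Set (Fin n)), w' s(p, q) = 0 := by
        intro p _ q hq
        have hqB : q ∈ B := by
          by_contra h; exact hq (Finset.mem_coe.2 (memS h))
        rw [Sym2.eq_swap]; exact hw'B q hqB p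
      rw [sahiE_principal_openConn_eq_openConnIn_of_no_exit w' (↑S) hSexit (Finset.mem_coe.2 (memS hsB)) k T]
      have hScard : S.card < n := by
        obtain ⟨x₀, hx₀⟩ := hBne
        have : x₀ ∉ S := fun h => (Finset.mem_sdiff.1 h).2 hx₀
        simpa [hcardn] using Finset.card_lt_univ_of_notMem this
      exact IH w' S hScard (memS hsB) k T fun i t ht => memS (hTB i t ht)
    -- (4) a targetless root side
    by_cases hI4 : ∀ (R : Finset (Fin n)) (h u v : Fin n), s ∈ R → h ∈ R → h ≠ s → u ∉ R → v ∉ R → u ≠ v →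
        (∀ i, ∀ t ∈ T i, t ∉ R) → ∃ x ∈ R, ∃ z, z ∉ R ∧ z ≠ u ∧ z ≠ v ∧ w s(x, z) ≠ 0
    swap
    · push Not at hI4
      obtain ⟨R, h, u, v, hsR, hhR, hhs, huR, hvR, huv, hTR, hside⟩ := hI4
      refine SahiRootSide.sahiE_principal_of_rootSide w R hsR hhR (Ne.symm hhs) huR hvR huv
        (fun x hx z hz hzu hzv => hside x hx z hz hzu hzv) (fun w' _ _ m T' hT' => ?_) k T hTR
      set S : Finset (Fin n) := Finset.univ.erase s with hSdef
      have hS : (↑S : Set (Fin n)) = {t : Fin n | t ≠ s} := by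
        ext t; simp [hSdef]
      have memS : ∀ {p : Fin n}, p ≠ s → p ∈ S := fun hp => Finset.mem_erase.2 ⟨hp, Finset.mem_univ _⟩
      have hScard : S.card < n := by
        rw [hSdef, Finset.card_erase_of_mem (Finset.mem_univ s), Finset.card_univ, hcardn]; omega
      have key := IH w' S hScard (memS hhs) m T' fun j t ht => memS (hT' j t ht)
      rwa [hS] at key
    -- (5) irreducible: the hypothesis
    exact H n w s k T hloop hI1 hI2 hI3 hI4
  -- transport to an arbitrary finite vertex type
  have key := sahiE_principal_openConnIn_of_fin (V := V) (m := Fintype.card V) (fun w₀ s k T => finv _ w₀ s k T) w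
    Finset.univ Finset.card_univ (Finset.mem_univ s) k T (fun i t _ => Finset.mem_univ t)
  rw [Finset.coe_univ] at key
  simpa only [openConn_eq_openConnIn_univ] using key

end IncStarIrreducible

end Summit.CriticalPhenomena.PercolationContinuityZ3.Theorems
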